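import Summits.Ventures.PercRepro.MSTightOneVertexSetup
import Summits.Ventures.PercRepro.MSTightNoMemberW
import Summits.Ventures.PercRepro.MSTightAnatomy

/-!
# The one-outside-vertex case (Theorem B of Addendum 38 §4), part II: `I`, `W`, the link inside
# `W`, `Λ ⊆ D(P)`, and the counts `|Λ| = |T₀| + 1`, `|D(P) ∖ Λ| = |P₁|`

Dossier proofs/MINE1-theoremS.md, Addendum 38 §3 (S2)–(S3), (NW), §4 (b), (c), (e), and
proofs/MINE1-RSTARM-PROOF.md §3, §4 (b), (c), (e). For a one-vertex residue instance
(MSTightOneVertexSetup.lean) let `W = {a ∈ u : u.erase a ∈ U}` and `I = u ∖ W` (the intersection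
of the members of `U` inside `u`). Then: no member contains `W` (MSTightNoMemberW.lean); every
valid set contains `W` and `I ≠ ∅` (MSTightAnatomy.lean); `W ∈ L'`, hence by (Sig) `I ∈ L'`;
`I ⊆ R`; the link `Λ` lies inside `W` and `W ∉ Λ`; so **every member of `Λ` is a face inside a
co-singleton `u.erase a ∈ T₀`, i.e. `Λ ⊆ D(P)`** (`link_subset_diffsX`); `Λ` is in bijection with
`T₀ ∪ {u}` by complementation (`card_link`); and with `|D(P)| = |P| + 1` and `P = T₀ ⊔ P₁`
(`P₁ = T₁ ∖ T₀` the partnerless members through `m`), **`|D(P) ∖ Λ| = |P₁|`**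
(`card_diffsX_sdiff_link`). Also `I ∈ D(P)` and `∅ ∉ T₁`.
-/

namespace PercRepro.MSTight

open Finset
open scoped FinsetFamily

variable {α : Type*} [DecidableEq α] [Fintype α]

namespace OneVertexData

variable {u : Finset α} {L' T : Finset (Finset α)} {m : α}

/-- The set `W = {a ∈ u : u.erase a ∈ U}`. -/
def W (u : Finset α) (L' : Finset (Finset α)) (m : α) : Finset α :=
  u.filter fun a => u.erase a ∈ upSet (insert m u) L'

/-- The set `I = u \ W` (the intersection of the members of `U` inside `u`). -/
def I (u : Finset α) (L' : Finset (Finset α)) (m : α) : Finset α := u \ W u L' m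

/-- Membership in `W`. -/
theorem mem_W {a : α} : a ∈ W u L' m ↔ a ∈ u ∧ u.erase a ∈ upSet (insert m u) L' := by
  simp [W]

/-- Membership in `I`. -/
theorem mem_I {a : α} : a ∈ I u L' m ↔ a ∈ u ∧ u.erase a ∉ upSet (insert m u) L' := by
  rw [I, mem_sdiff, mem_W]
  tauto

/-- `I ⊆ u`, `W ⊆ u`. -/
theorem I_subset : I u L' m ⊆ u := sdiff_subset

/-- `W ⊆ u`. -/
theorem W_subset : W u L' m ⊆ u := filter_subset _ _

/-- `I` and `W` are disjoint. -/
theorem disjoint_I_W : Disjoint (I u L' m) (W u L' m) := sdiff_disjoint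

/-- `u = I ∪ W`. -/
theorem I_union_W : I u L' m ∪ W u L' m = u := sdiff_union_of_subset W_subset

/-- **(NW).** No member of `T` contains `W`. -/
theorem not_W_subset (d : OneVertexData u L' T m) {y : Finset α} (hy : y ∈ T) :
    ¬ W u L' m ⊆ y :=
  not_filter_erase_mem_subset d.inst.upSet_up d.inst.subset_upSet
    (fun _ hy => d.inst.not_subset_of_mem hy) (d.inst.outside_data' d.hnt d.hB) hy

/-- Every member of `U` inside `u` contains `I`. -/
theorem I_subset_of_mem_upSet (d : OneVertexData u L' T m) {x : Finset α}
    (hx : x ∈ upSet (insert m u) L') (hxu : x ⊆ u) : I u L' m ⊆ x := by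
  intro a ha
  rw [mem_I] at ha
  by_contra hax
  exact ha.2 (d.inst.upSet_up x hx _ (subset_erase.2 ⟨hxu, hax⟩))

/-- Every member of `T₀` contains `I`. -/
theorem I_subset_of_mem_part0 (d : OneVertexData u L' T m) {x : Finset α}
    (hx : x ∈ part0 m T) : I u L' m ⊆ x :=
  d.I_subset_of_mem_upSet (d.mem_part0_iff.1 hx).2.2 (d.mem_part0_iff.1 hx).1

/-- `I ⊆ R`. -/
theorem I_subset_Rstar (d : OneVertexData u L' T m) : I u L' m ⊆ Rstar (partner m T) :=
  d.I_subset_of_mem_part0 (mem_inter.1 d.Rstar_mem).1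

/-- **(S3).** Every valid set contains `W`. -/
theorem W_subset_of_valid (d : OneVertexData u L' T m) {v : Finset α} (hvu : v ⊆ u)
    (hvC : v ∉ cpx T) : W u L' m ⊆ v := by
  intro a ha
  rw [mem_W] at ha
  by_contra hav
  exact erase_notMem_of_valid (C := cpx T) (fun t ht x hx => mem_cpx_of_subset ht hx) d.hS1 hvu hvC
    ha.1 hav ha.2

/-- **(S2).** `I ≠ ∅`. -/
theorem I_nonempty (d : OneVertexData u L' T m) : (I u L' m).Nonempty := by
  obtain ⟨v₀, hv₀, hv₀u, -, hv₀T⟩ := d.inst.hao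
  have hv₀C : v₀ ∉ cpx T := by
    intro h
    obtain ⟨t, ht, hvt⟩ := mem_cpx.1 h
    exact hv₀T t ht hvt
  obtain ⟨a, ha, ha'⟩ := exists_erase_notMem (C := cpx T) (fun t ht x hx => mem_cpx_of_subset ht hx)
    d.hS1 d.inst.hu hv₀ hv₀u hv₀C
  exact ⟨a, mem_I.2 ⟨ha, ha'⟩⟩

/-- `W ∈ L'`. -/
theorem W_mem (d : OneVertexData u L' T m) : W u L' m ∈ L' := by
  obtain ⟨v₀, hv₀, hv₀u, -, hv₀T⟩ := d.inst.hao
  have hv₀C : v₀ ∉ cpx T := by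
    intro h
    obtain ⟨t, ht, hvt⟩ := mem_cpx.1 h
    exact hv₀T t ht hvt
  exact d.inst.hdown _ hv₀ _ (d.W_subset_of_valid hv₀u hv₀C)

/-- `W` is not a face. -/
theorem W_notMem_cpx (d : OneVertexData u L' T m) : W u L' m ∉ cpx T := by
  intro h
  obtain ⟨t, ht, hWt⟩ := mem_cpx.1 h
  exact d.not_W_subset ht hWt

/-- **(S3').** `I ∈ L'` ((Sig) at the valid set `W`). -/
theorem I_mem (d : OneVertexData u L' T m) : I u L' m ∈ L' := by
  rcases d.inst.hsig _ d.W_mem W_subset with h | ⟨y, hy, hWy⟩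
  · exact h
  · exact absurd hWy (d.not_W_subset hy)

/-- `W ≠ ∅`: otherwise `I = u` and `T₀ = ∅`, but `R ∈ T₀`. -/
theorem W_nonempty (d : OneVertexData u L' T m) : (W u L' m).Nonempty := by
  rw [nonempty_iff_ne_empty]
  intro hW
  have hIu : I u L' m = u := by rw [I, hW, sdiff_empty]
  have hR := d.I_subset_of_mem_part0 (mem_inter.1 d.Rstar_mem).1
  rw [hIu] at hR
  exact d.inst.not_subset_of_mem (RInst.mem_of_mem_partner d.Rstar_mem) hR

/-- The link lies inside `W`: a member of `Λ` is disjoint from `I`. -/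
theorem disjoint_I_of_mem_link (d : OneVertexData u L' T m) {g : Finset α}
    (hg : g ∈ link (upSet (insert m u) L') u) : Disjoint (I u L' m) g := by
  rw [disjoint_left]
  intro a haI hag
  rw [mem_I] at haI
  obtain ⟨hgu, hg'⟩ := mem_link.1 hg
  exact haI.2 (d.inst.upSet_up _ hg' _ (fun b hb => mem_erase.2
    ⟨fun h => (mem_sdiff.1 hb).2 (h ▸ hag), (mem_sdiff.1 hb).1⟩))

/-- The link lies inside `W`. -/
theorem subset_W_of_mem_link (d : OneVertexData u L' T m) {g : Finset α}
    (hg : g ∈ link (upSet (insert m u) L') u) : g ⊆ W u L' m := by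
  intro a hag
  have hau : a ∈ u := (mem_link.1 hg).1 hag
  have : a ∉ I u L' m := disjoint_right.1 (d.disjoint_I_of_mem_link hg) hag
  rw [mem_I] at this
  rw [mem_W]
  exact ⟨hau, by_contra fun h => this ⟨hau, h⟩⟩

/-- `W ∉ Λ`: otherwise `I ∈ U` would be a member lying in `L'`. -/
theorem W_notMem_link (d : OneVertexData u L' T m) : W u L' m ∉ link (upSet (insert m u) L') u := by
  intro hW
  obtain ⟨-, hI⟩ := mem_link.1 hW
  have hIne : u \ W u L' m ≠ u := by
    intro h
    obtain ⟨a, ha⟩ := d.W_nonempty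
    have : a ∈ u \ W u L' m := by rw [h]; exact W_subset ha
    exact (mem_sdiff.1 this).2 ha
  have hIT := d.hS1 _ hI sdiff_subset hIne
  exact d.hnw _ hIT d.I_mem

/-- `{a} ∈ Λ` for `a ∈ W`, and `u.erase a ∈ T₀`. -/
theorem erase_mem_part0_of_mem_W (d : OneVertexData u L' T m) {a : α} (ha : a ∈ W u L' m) :
    u.erase a ∈ part0 m T := by
  rw [mem_W] at ha
  exact d.mem_part0_iff.2 ⟨erase_subset a u, fun h => (mem_erase.1 (h ▸ ha.1)).1 rfl, ha.2⟩

/-- `{a} ∈ Λ` for `a ∈ W`. -/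
theorem singleton_mem_link_of_mem_W {a : α} (ha : a ∈ W u L' m) :
    ({a} : Finset α) ∈ link (upSet (insert m u) L') u := by
  rw [mem_W] at ha
  rw [mem_link, sdiff_singleton_eq_erase]
  exact ⟨singleton_subset_iff.2 ha.1, ha.2⟩

/-- **`Λ ⊆ D(P)`:** every member of `Λ` is a face avoiding `m` inside a co-singleton
`u.erase a ∈ T₀` (`a ∈ W ∖ g`). -/
theorem link_subset_diffsX (d : OneVertexData u L' T m) :
    link (upSet (insert m u) L') u ⊆ diffsX m T := by
  intro g hg
  have hgW := d.subset_W_of_mem_link hg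
  have hgne : g ≠ W u L' m := fun h => d.W_notMem_link (h ▸ hg)
  obtain ⟨a, haW, hag⟩ := exists_of_ssubset (ssubset_of_subset_of_ne hgW hgne)
  rw [d.mem_diffsX_iff']
  refine ⟨d.mem_of_mem_link' hg, fun h => d.hmu ((mem_link.1 hg).1 h), u.erase a,
    (mem_part0.1 (d.erase_mem_part0_of_mem_W haW)).1, ?_⟩
  intro b hb
  exact mem_erase.2 ⟨fun h => hag (h ▸ hb), (mem_link.1 hg).1 hb⟩

/-- `Λ` is the image of `T₀ ∪ {u}` under complementation in `u`. -/
theorem link_eq_image (d : OneVertexData u L' T m) :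
    link (upSet (insert m u) L') u = (insert u (part0 m T)).image fun x => u \ x := by
  ext g
  simp only [mem_image, mem_insert]
  constructor
  · intro hg
    obtain ⟨hgu, hg'⟩ := mem_link.1 hg
    refine ⟨u \ g, ?_, Finset.sdiff_sdiff_eq_self hgu⟩
    by_cases h : u \ g = u
    · exact Or.inl h
    · exact Or.inr (d.mem_part0_iff.2 ⟨sdiff_subset, h, hg'⟩)
  · rintro ⟨x, hx, rfl⟩
    rcases hx with rfl | hx
    · rw [Finset.sdiff_self]
      exact d.inst.empty_mem_link
    · obtain ⟨hxu, -, hxU⟩ := d.mem_part0_iff.1 hx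
      rw [mem_link, Finset.sdiff_sdiff_eq_self hxu]
      exact ⟨sdiff_subset, hxU⟩

/-- **`|Λ| = |T₀| + 1`.** -/
theorem card_link (d : OneVertexData u L' T m) :
    (link (upSet (insert m u) L') u).card = (part0 m T).card + 1 := by
  rw [d.link_eq_image, card_image_of_injOn, card_insert_of_notMem]
  · intro hu
    exact d.inst.not_subset_of_mem (mem_part0.1 hu).1 (subset_refl u)
  · intro x hx x' hx' hxx'
    have hxu : x ⊆ u := by
      rcases mem_insert.1 (mem_coe.1 hx) with rfl | h
      · exact subset_refl _
      · exact d.subset_of_mem_part0 h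
    have hx'u : x' ⊆ u := by
      rcases mem_insert.1 (mem_coe.1 hx') with rfl | h
      · exact subset_refl _
      · exact d.subset_of_mem_part0 h
    exact eq_of_sdiff_eq_of_subset hxu hx'u hxx'

omit [Fintype α] in
/-- `P = T₀ ⊔ P₁` with `P₁ = T₁ ∖ T₀`: the count. -/
theorem card_proj_eq (m : α) (T : Finset (Finset α)) :
    (proj m T).card = (part0 m T).card + (partr m T \ part0 m T).card := by
  rw [proj_eq_union, ← card_union_of_disjoint disjoint_sdiff, union_sdiff_self_eq_union]

/-- **`|D(P) ∖ Λ| = |P₁|`.** -/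
theorem card_diffsX_sdiff_link (d : OneVertexData u L' T m) :
    (diffsX m T \ link (upSet (insert m u) L') u).card = (partr m T \ part0 m T).card := by
  have h1 := card_sdiff_add_card_eq_card d.link_subset_diffsX
  have h2 := d.card_diffsX
  have h3 := d.card_link
  have h4 := card_proj_eq m T
  omega

/-- `I ∈ D(P)`: `I ∈ L'`, `m ∉ I`, `I ⊆ R ∈ T`. -/
theorem I_mem_diffsX (d : OneVertexData u L' T m) : I u L' m ∈ diffsX m T := by
  rw [d.mem_diffsX_iff']
  exact ⟨d.I_mem, fun h => d.hmu (I_subset h), Rstar (partner m T),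
    RInst.mem_of_mem_partner d.Rstar_mem, d.I_subset_Rstar⟩

omit [Fintype α] in
/-- `∅ ∉ T₁`: `{m}` would be a witness. -/
theorem empty_notMem_partr (d : OneVertexData u L' T m) : (∅ : Finset α) ∉ partr m T := by
  intro h
  obtain ⟨-, hm⟩ := mem_partr.1 h
  rw [insert_empty] at hm
  exact d.hnw _ hm (d.inst.hsing m (mem_insert_self m u))

end OneVertexData

end PercRepro.MSTight
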